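import Mathlib
import HarnessLib
import Literature.Analysis.SpecialFunctions.LogChooseStirling
import Summits.KontsevichZagierPeriods.Zeta5Search.Denom.TwoTaleD1Forms
import Summits.KontsevichZagierPeriods.Zeta5Search.TwoTaleP15Growth

/-!
# TwoTaleD1Growth — the coefficient rate at RUNG D1 = L(1/3) `(19,16,13,22 | 0,3,6,38)`: Whipple's partner is a one-signed sum

HONEST FRAMING: systematic search; no irrationality claim unless certified.  Cell pub-zeta5 (P1 g12, file T7 of
fam-denom's `families/denom/D1-DESIGN-NOTE.md`); the D1 port of fam-measure's `TwoTaleR3Growth` / `TwoTaleP15Growth`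
(same six lemmas, new slopes): NO recurrence and NO saddle point —

* on the two-tale cone `q_n = −q̂_n` is **Whipple's terminating transformation** ([Zudilin2014ZetaTwo] Remark 5; in the
  tree `TwoTaleWhipple.whippleRemark5Max_holds`, instantiated at D1 in `TwoTaleWhippleD1`); at D1 the partner sum is
  `qhatD1 n = Σ_k termD1 n k` at the Remark-5 partner parameters `â = (47n+2; 16n+1, 19n+1, 22n+1)`,
  `b̂ = (22n+2; 9n+1, 35n+2, 38n+2)`;
* the summands are ONE-SIGNED BY FORMULA:
  `termD1 n k = C(2k−22n−2, 25n)·C(k−9n−1, 7n)·C(16n, k−19n−1)·C(16n, k−22n−1) ≥ 0` (Zudilin's `A_k`,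
  arXiv:1310.1526 §6 eq. (T2)), so `max_k ≤ qhatD1 n ≤ (16n+1)·max_k`;
* THIS PART: the partner sum, the tangent slopes `σᵢ(u)` (`u = k/n ∈ (47/2, 35)`), the affine Chernoff exponent
  `n·Λ(u) + k·G(u) + K₀(u)`, the critical abscissa `ustarD1 ∈ [57/2, 34]` with `slopeGD1 ustarD1 = 0` (IVT from
  `slopeGD1 (57/2) = −2 log(2/7) − log(25/39) > 0 > slopeGD1 34 = log 5290 − log 35721`; numerically
  `ustarD1 = 32.2295248…`), `C₁starD1 := rateΛD1 ustarD1` (numerically `60.8078797…`; design `C₁ = 60.80787975`) and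
  the upper bound `qhatD1_le`; the generic Chernoff lemmas are those of `TwoTaleP15Growth`.
Sequels: `TwoTaleD1GrowthLimit` (the limit `log qhatD1 n / n → C₁starD1` and `CoeffRateD1` from Whipple),
`TwoTaleD1GrowthEnclosure` (`C₁starD1 ≤ 60.808`).  Nothing here certifies a measure; no irrationality content.
Design numerics: `HOME/code/p1/g12/d1_growth.py`.
References: W. N. Bailey, Generalized hypergeometric series (1935) §4.5; W. Zudilin, arXiv:1310.1526
[Zudilin2014ZetaTwo] §6, Remark 5.
-/

noncomputable section

open Filter Topology Finset Real

namespace Summit.KontsevichZagierPeriods.Zeta5Search.TwoTaleD1Growth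

open Summit.KontsevichZagierPeriods.Zeta5Search.Denom.TwoTaleD1Forms (formQD1 CoeffRateD1)
open Summit.KontsevichZagierPeriods.Zeta5Search.TwoTaleP15Growth (choose_le_exp exp_le_choose prod4_le)

/-! ### The partner sum (tale 2 at the Remark-5 parameters of D1) -/

/-- Zudilin's `A_k` (arXiv:1310.1526 §6, eq. (T2)) at the D1 partner: the product of four binomials
`C(2k−22n−2, 25n)·C(k−9n−1, 7n)·C(16n, k−19n−1)·C(16n, k−22n−1)` — a natural number, nonzero exactly for
`⌈(47n+2)/2⌉ ≤ k ≤ 35n+1` (inside the summation window `22n+1 ≤ k ≤ 38n+1` no truncated subtraction occurs). -/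
def termD1 (n k : ℕ) : ℕ :=
  Nat.choose (2 * k - (22 * n + 2)) (25 * n) * Nat.choose (k - (9 * n + 1)) (7 * n) *
    Nat.choose (16 * n) (k - (19 * n + 1)) * Nat.choose (16 * n) (k - (22 * n + 1))

/-- `qhatD1 n = Σ_{k=22n+1}^{38n+1} A_k = |q̂_n|` (`= Zudilin2014.formQTZ â b̂`, `TwoTaleWhippleD1`). -/
def qhatD1 (n : ℕ) : ℕ := ∑ k ∈ Ico (22 * n + 1) (38 * n + 2), termD1 n k

/-! ### The tangent slopes and the affine exponent -/

/-- Slope of the block `C(2k−22n−2, 25n)` at abscissa `u = k/n`: `σ₀ = 25/(2u−22)`. -/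
def σ₀ (u : ℝ) : ℝ := 25 / (2 * u - 22)
/-- Slope of `C(k−9n−1, 7n)`: `σ₁ = 7/(u−9)`. -/
def σ₁ (u : ℝ) : ℝ := 7 / (u - 9)
/-- Slope of `C(16n, k−19n−1)`: `σ₂ = (u−19)/16`. -/
def σ₂ (u : ℝ) : ℝ := (u - 19) / 16
/-- Slope of `C(16n, k−22n−1)`: `σ₃ = (u−22)/16`. -/
def σ₃ (u : ℝ) : ℝ := (u - 22) / 16

/-- The `n`-coefficient `Λ(u)` of the total Chernoff exponent at slopes `σᵢ(u)`. -/
def rateΛD1 (u : ℝ) : ℝ :=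
  -25 * Real.log (σ₀ u) + 47 * Real.log (1 - σ₀ u) - 7 * Real.log (σ₁ u) + 16 * Real.log (1 - σ₁ u) +
    19 * Real.log (σ₂ u) - 35 * Real.log (1 - σ₂ u) + 22 * Real.log (σ₃ u) - 38 * Real.log (1 - σ₃ u)

/-- The `k`-coefficient `G(u)` of the total Chernoff exponent (`= h′(u)`, the derivative of the max-term entropy):
`G(u) = 2 log((2u−22)/(2u−47)) + log((u−9)/(u−16)) + log((35−u)/(u−19)) + log((38−u)/(u−22))`. -/
def slopeGD1 (u : ℝ) : ℝ :=
  -2 * Real.log (1 - σ₀ u) - Real.log (1 - σ₁ u) - Real.log (σ₂ u) + Real.log (1 - σ₂ u) - Real.log (σ₃ u) +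
    Real.log (1 - σ₃ u)

/-- The constant term `K₀(u)` of the total Chernoff exponent (from the `−2, −1, −1, −1` offsets). -/
def constKD1 (u : ℝ) : ℝ :=
  2 * Real.log (1 - σ₀ u) + Real.log (1 - σ₁ u) + Real.log (σ₂ u) - Real.log (1 - σ₂ u) + Real.log (σ₃ u) -
    Real.log (1 - σ₃ u)

/-- The four Chernoff exponents add up to the AFFINE form `n·Λ(u) + k·G(u) + K₀(u)`. -/
theorem affine_eq (u : ℝ) (n k : ℝ) :
    (25 * n * (-Real.log (σ₀ u)) + (2 * k - 22 * n - 2 - 25 * n) * (-Real.log (1 - σ₀ u))) +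
      (7 * n * (-Real.log (σ₁ u)) + (k - 9 * n - 1 - 7 * n) * (-Real.log (1 - σ₁ u))) +
      ((k - 19 * n - 1) * (-Real.log (σ₂ u)) + (16 * n - (k - 19 * n - 1)) * (-Real.log (1 - σ₂ u))) +
      ((k - 22 * n - 1) * (-Real.log (σ₃ u)) + (16 * n - (k - 22 * n - 1)) * (-Real.log (1 - σ₃ u))) =
    n * rateΛD1 u + k * slopeGD1 u + constKD1 u := by
  unfold rateΛD1 slopeGD1 constKD1; ring

/-- The slopes lie in `(0,1)` for `47/2 < u < 35`. -/
theorem slopes_mem {u : ℝ} (hu : 47 / 2 < u) (hu' : u < 35) :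
    (0 < σ₀ u ∧ σ₀ u < 1) ∧ (0 < σ₁ u ∧ σ₁ u < 1) ∧ (0 < σ₂ u ∧ σ₂ u < 1) ∧ (0 < σ₃ u ∧ σ₃ u < 1) := by
  unfold σ₀ σ₁ σ₂ σ₃
  have h22 : 0 < 2 * u - 22 := by linarith
  have h9 : 0 < u - 9 := by linarith
  have h19 : 0 < u - 19 := by linarith
  have h22' : 0 < u - 22 := by linarith
  refine ⟨⟨by positivity, ?_⟩, ⟨by positivity, ?_⟩, ⟨by positivity, ?_⟩, ⟨by positivity, ?_⟩⟩
  · rw [div_lt_one h22]; linarith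
  · rw [div_lt_one h9]; linarith
  · rw [div_lt_one (by norm_num : (0:ℝ) < 16)]; linarith
  · rw [div_lt_one (by norm_num : (0:ℝ) < 16)]; linarith

/-! ### Upper half: every summand is below the tangent plane -/

/-- **Tangent-plane bound**: for `22n+1 ≤ k` and `47/2 < u < 35`, `termD1 n k ≤ exp(n·Λ(u) + k·G(u) + K₀(u))`. -/
theorem termD1_le_exp (n k : ℕ) (hk : 22 * n + 1 ≤ k) {u : ℝ} (hu : 47 / 2 < u) (hu' : u < 35) :
    (termD1 n k : ℝ) ≤ Real.exp (n * rateΛD1 u + k * slopeGD1 u + constKD1 u) := by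
  obtain ⟨⟨a0, b0⟩, ⟨a1, b1⟩, ⟨a2, b2⟩, ⟨a3, b3⟩⟩ := slopes_mem hu hu'
  have e0 : ((2 * k - (22 * n + 2) : ℕ) : ℝ) = 2 * k - 22 * n - 2 := by
    rw [Nat.cast_sub (by omega)]; push_cast; ring
  have e1 : ((k - (9 * n + 1) : ℕ) : ℝ) = k - 9 * n - 1 := by
    rw [Nat.cast_sub (by omega)]; push_cast; ring
  have e2 : ((k - (19 * n + 1) : ℕ) : ℝ) = k - 19 * n - 1 := by
    rw [Nat.cast_sub (by omega)]; push_cast; ring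
  have e3 : ((k - (22 * n + 1) : ℕ) : ℝ) = k - 22 * n - 1 := by
    rw [Nat.cast_sub (by omega)]; push_cast; ring
  have g0 := choose_le_exp (2 * k - (22 * n + 2)) (25 * n) a0 b0
  have g1 := choose_le_exp (k - (9 * n + 1)) (7 * n) a1 b1
  have g2 := choose_le_exp (16 * n) (k - (19 * n + 1)) a2 b2
  have g3 := choose_le_exp (16 * n) (k - (22 * n + 1)) a3 b3
  rw [e0] at g0; rw [e1] at g1; rw [e2] at g2; rw [e3] at g3
  unfold termD1
  push_cast
  refine (prod4_le (by positivity) (by positivity) (by positivity) (by positivity) g0 g1 g2 g3).trans (le_of_eq ?_)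
  rw [← Real.exp_add, ← Real.exp_add, ← Real.exp_add]
  congr 1
  rw [← affine_eq u n k]
  push_cast
  ring

/-! ### The critical abscissa `ustarD1`: the root of `slopeGD1` -/

/-- `slopeGD1` is continuous at every `u ∈ (47/2, 35)`. -/
theorem slopeGD1_continuousAt {u : ℝ} (hu : 47 / 2 < u) (hu' : u < 35) : ContinuousAt slopeGD1 u := by
  obtain ⟨⟨a0, b0⟩, ⟨a1, b1⟩, ⟨a2, b2⟩, ⟨a3, b3⟩⟩ := slopes_mem hu hu'
  unfold σ₀ at a0 b0; unfold σ₁ at a1 b1; unfold σ₂ at a2 b2; unfold σ₃ at a3 b3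
  have h1 : (2 * u - 22) ≠ 0 := (by linarith : (0:ℝ) < 2 * u - 22).ne'
  have h2 : u - 9 ≠ 0 := (by linarith : (0:ℝ) < u - 9).ne'
  have h3 : 1 - 25 / (2 * u - 22) ≠ 0 := (by linarith : (0:ℝ) < 1 - 25 / (2 * u - 22)).ne'
  have h4 : 1 - 7 / (u - 9) ≠ 0 := (by linarith : (0:ℝ) < 1 - 7 / (u - 9)).ne'
  have h5 : (u - 19) / 16 ≠ 0 := a2.ne'
  have h6 : 1 - (u - 19) / 16 ≠ 0 := (by linarith : (0:ℝ) < 1 - (u - 19) / 16).ne'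
  have h7 : (u - 22) / 16 ≠ 0 := a3.ne'
  have h8 : 1 - (u - 22) / 16 ≠ 0 := (by linarith : (0:ℝ) < 1 - (u - 22) / 16).ne'
  unfold slopeGD1 σ₀ σ₁ σ₂ σ₃
  fun_prop (disch := assumption)

/-- `slopeGD1 (57/2) > 0` (`= −2 log(2/7) − log(25/39)`: at `u = 57/2` one has `σ₂ + σ₃ = 1`, so the last four
terms cancel). -/
theorem slopeGD1_left_pos : 0 < slopeGD1 (57 / 2) := by
  have h1 : Real.log (2 / 7) < 0 := Real.log_neg (by norm_num) (by norm_num)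
  have h2 : Real.log (25 / 39) < 0 := Real.log_neg (by norm_num) (by norm_num)
  have e : slopeGD1 (57 / 2) = -2 * Real.log (2 / 7) - Real.log (25 / 39) - Real.log (19 / 32) + Real.log (13 / 32) -
      Real.log (13 / 32) + Real.log (19 / 32) := by
    unfold slopeGD1 σ₀ σ₁ σ₂ σ₃; norm_num
  rw [e]; linarith

/-- `slopeGD1 34 < 0`: at `u = 34` the slopes are `25/46, 7/25, 15/16, 3/4` and the six logarithms collapse to
`log 5290 − log 35721 < 0` (`5290 = 2·5·23²`, `35721 = 3⁶·7²`). -/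
theorem slopeGD1_right_neg : slopeGD1 34 < 0 := by
  have e : slopeGD1 34 = -2 * Real.log (21 / 46) - Real.log (18 / 25) - Real.log (15 / 16) +
      Real.log (1 / 16) - Real.log (3 / 4) + Real.log (1 / 4) := by
    unfold slopeGD1 σ₀ σ₁ σ₂ σ₃; norm_num
  have d1 : Real.log (21 / 46) = Real.log 21 - Real.log 46 := Real.log_div (by norm_num) (by norm_num)
  have d2 : Real.log (18 / 25) = Real.log 18 - Real.log 25 := Real.log_div (by norm_num) (by norm_num)
  have d3 : Real.log (15 / 16) = Real.log 15 - Real.log 16 := Real.log_div (by norm_num) (by norm_num)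
  have d4 : Real.log (1 / 16) = Real.log 1 - Real.log 16 := Real.log_div (by norm_num) (by norm_num)
  have d5 : Real.log (3 / 4) = Real.log 3 - Real.log 4 := Real.log_div (by norm_num) (by norm_num)
  have d6 : Real.log (1 / 4) = Real.log 1 - Real.log 4 := Real.log_div (by norm_num) (by norm_num)
  have m21 : Real.log 21 = Real.log 3 + Real.log 7 := by
    rw [show (21:ℝ) = 3 * 7 by norm_num, Real.log_mul (by norm_num) (by norm_num)]
  have m46 : Real.log 46 = Real.log 2 + Real.log 23 := by
    rw [show (46:ℝ) = 2 * 23 by norm_num, Real.log_mul (by norm_num) (by norm_num)]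
  have m18 : Real.log 18 = Real.log 2 + 2 * Real.log 3 := by
    rw [show (18:ℝ) = 2 * 3 ^ 2 by norm_num, Real.log_mul (by norm_num) (by norm_num), Real.log_pow]; norm_num
  have m25 : Real.log 25 = 2 * Real.log 5 := by
    rw [show (25:ℝ) = 5 ^ 2 by norm_num, Real.log_pow]; norm_num
  have m15 : Real.log 15 = Real.log 3 + Real.log 5 := by
    rw [show (15:ℝ) = 3 * 5 by norm_num, Real.log_mul (by norm_num) (by norm_num)]
  have m5290 : Real.log 5290 = Real.log 2 + Real.log 5 + 2 * Real.log 23 := by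
    rw [show (5290:ℝ) = 2 * 5 * 23 ^ 2 by norm_num, Real.log_mul (by norm_num) (by norm_num),
      Real.log_mul (by norm_num) (by norm_num), Real.log_pow]; norm_num
  have m35721 : Real.log 35721 = 6 * Real.log 3 + 2 * Real.log 7 := by
    rw [show (35721:ℝ) = 3 ^ 6 * 7 ^ 2 by norm_num, Real.log_mul (by norm_num) (by norm_num), Real.log_pow,
      Real.log_pow]; norm_num
  have hlt : Real.log 5290 < Real.log 35721 := Real.log_lt_log (by norm_num) (by norm_num)
  rw [e, d1, d2, d3, d4, d5, d6, Real.log_one]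
  linarith

/-- **IVT**: `slopeGD1` has a zero in `[57/2, 34]`. -/
theorem exists_root : ∃ u ∈ Set.Icc (57 / 2 : ℝ) 34, slopeGD1 u = 0 := by
  have hcont : ContinuousOn slopeGD1 (Set.Icc (57 / 2 : ℝ) 34) := fun u hu =>
    (slopeGD1_continuousAt (by linarith [hu.1]) (by linarith [hu.2])).continuousWithinAt
  have h := intermediate_value_Icc' (by norm_num : (57 / 2 : ℝ) ≤ 34) hcont
  have h0 : (0:ℝ) ∈ Set.Icc (slopeGD1 34) (slopeGD1 (57 / 2)) := ⟨slopeGD1_right_neg.le, slopeGD1_left_pos.le⟩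
  obtain ⟨u, hu, hu0⟩ := h h0
  exact ⟨u, hu, hu0⟩

/-- The critical abscissa `u* ∈ [57/2, 34]` with `G(u*) = 0` (numerically `u* = 32.2295248…`, the relevant root of
`(2u−22)²(u−9)(35−u)(38−u) = (2u−47)²(u−16)(u−19)(u−22)`). -/
def ustarD1 : ℝ := exists_root.choose

/-- The defining property of `ustarD1`: it lies in `[57/2, 34]` and `slopeGD1 ustarD1 = 0`. -/
theorem ustarD1_spec : ustarD1 ∈ Set.Icc (57 / 2 : ℝ) 34 ∧ slopeGD1 ustarD1 = 0 := exists_root.choose_spec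

/-- `ustarD1` lies in the open window `(47/2, 35)` where all four slopes are in `(0, 1)`. -/
theorem ustarD1_bounds : 47 / 2 < ustarD1 ∧ ustarD1 < 35 :=
  ⟨by linarith [ustarD1_spec.1.1], by linarith [ustarD1_spec.1.2]⟩

/-- **The coefficient rate** `C₁* = Λ(u*)` at D1: the height of the horizontal tangent plane of the max-term
entropy (numerically `60.8078797…`; the enclosure `≤ 60.808` is `TwoTaleD1GrowthEnclosure.C₁starD1_le`). -/
def C₁starD1 : ℝ := rateΛD1 ustarD1

/-- The bounded penalty constant of the reverse-Chernoff step at `k_n = ⌊u* n⌋`. -/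
def penPD1 : ℝ :=
  9 / (σ₀ ustarD1 * (1 - σ₀ ustarD1)) + 1 / (σ₁ ustarD1 * (1 - σ₁ ustarD1)) + 4 / (σ₂ ustarD1 * (1 - σ₂ ustarD1)) +
    4 / (σ₃ ustarD1 * (1 - σ₃ ustarD1))

/-! ### Upper bound for `qhatD1` -/

/-- **Upper half**: `qhatD1 n ≤ (16n+1)·exp(n·C₁* + K₀(u*))` for every `n`. -/
theorem qhatD1_le (n : ℕ) : (qhatD1 n : ℝ) ≤ (16 * n + 1) * Real.exp (n * C₁starD1 + constKD1 ustarD1) := by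
  obtain ⟨hu1, hu2⟩ := ustarD1_bounds
  have hG := ustarD1_spec.2
  have hc : (Ico (22 * n + 1) (38 * n + 2)).card = 16 * n + 1 := by simp; omega
  unfold qhatD1
  push_cast
  calc ∑ k ∈ Ico (22 * n + 1) (38 * n + 2), (termD1 n k : ℝ)
      ≤ ∑ k ∈ Ico (22 * n + 1) (38 * n + 2), Real.exp (n * C₁starD1 + constKD1 ustarD1) := by
        apply Finset.sum_le_sum
        intro k hk
        have hk1 : 22 * n + 1 ≤ k := (Finset.mem_Ico.mp hk).1
        have h := termD1_le_exp n k hk1 hu1 hu2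
        rw [hG, mul_zero, add_zero] at h
        exact h
    _ = (16 * n + 1) * Real.exp (n * C₁starD1 + constKD1 ustarD1) := by
        rw [Finset.sum_const, hc, nsmul_eq_mul]; push_cast; ring

end Summit.KontsevichZagierPeriods.Zeta5Search.TwoTaleD1Growth

end
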